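import Summits.Ventures.Crystal3D.Theorems.StickyWulffConstantGenericWallFloorExactOnlyTransport
import HarnessLib

/-!
# A twelve-fold ball carrying an exact-only own pattern is close-packed (the located atom of the terrace census's rim / roof laws; memo BETA-ASSEMBLY-g18 §2 (L1)/(L2), §4 T3–T4)

HONEST FRAMING. Venture `Summits/Ventures/Crystal3D` (cell `crystal3d-full`), helper `--supports` the law-v5 crux `TextureLiminfV5`
(stmt-Ventures-23912), lane T, line `TexShadow`, registered stub `stub_terraceCensus` (mechanism (β)).  A two-line consequence of the
definition of `ExactOnly` (…GenericWallFloorExactOnly) stated in the DICHOTOMY form the census's located laws consume; the exact-only input is the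
registered E1 row (`stub_E1` / `P5Exhaustion`, closed vertex star P₅, cf-p2 R38) transported by `ExactOnly.image`; nothing is certified here;
F-C1 not moved.

THE POINT.  The census pays at RIM balls (the occupied slot sites bounding a registry region in a walled layer) and at path END balls (the
occupied successor site of the last cp-saturated ball of a lattice path): such a ball `x` is adjacent to a cp-saturated ball `b`, hence carries the
exact 5-ball EDGE STAR {`b`, the four common neighbours} ⊆ its contacts — a rigid-motion image of the P₅ own pattern (fcc, and the hcp POLAR edge;
the hcp IN-PLANE edge star is a different orbit, Q1 of the memo).  DICHOTOMY: either `x` has at most eleven contacts — it PAYS `½` — or its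
contact shell is a close-packed dozen — it is cp-saturated and the rigidity/label propagation continues through it (`fccDozen_eq_slots_of_three_independent` /
`hcpDozen_twin_of_three_independent`, …SlotDozens; `twinPlane_propagates`).  No `SingleDozen` hypothesis and no empty slot are needed for this form
(contrast `unsaturated_of_exactOnly`, which concludes `≤ 11` from an empty slot).
* `isKissingAround_contacts` — the contact shell of a ball of a `1`-separated configuration is a kissing arrangement;
* **`card_le_eleven_or_closePacked_of_exactOnly`** — own pattern `O ⊆ contacts(x)` exact-only ⇒ `#contacts(x) ≤ 11 ∨ IsClosePackedDozenAt x (contacts x)`;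
* **`card_le_eleven_or_closePacked_of_exactOnly_image`** — the same with the certificate given at the origin in a cubic frame and transported by a rigid
  motion `(L, x)` (the form in which `exactOnly_star_of_p5Exhaustion` delivers E1).
WHAT THIS IS NOT: any certificate; the hcp in-plane edge star; F-C1 not moved.
-/

noncomputable section

namespace Summit.Ventures.Crystal3D.Theorems

open Finset Literature.Geometry.DiscreteGeometry

/-- The contact shell of a ball in a `1`-separated configuration is a kissing arrangement around it. -/
theorem isKissingAround_contacts (X : Finset (EuclideanSpace ℝ (Fin 3)))
    (hX : ∀ p ∈ X, ∀ q ∈ X, p ≠ q → 1 ≤ dist p q) (x : EuclideanSpace ℝ (Fin 3)) :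
    IsKissingAround x (X.filter fun q => dist x q = 1) :=
  ⟨fun _ hs => (Finset.mem_filter.mp hs).2,
    fun s hs t ht hst => hX s (Finset.mem_filter.mp hs).1 t (Finset.mem_filter.mp ht).1 hst⟩

/-- **PAY OR PROPAGATE.**  If an exact-only own pattern `O` around `x` lies inside the contact shell of `x` in a `1`-separated configuration `X`,
then either `x` has at most eleven contacts, or its contact shell is a close-packed dozen around `x`. -/
theorem card_le_eleven_or_closePacked_of_exactOnly (X : Finset (EuclideanSpace ℝ (Fin 3)))
    (hX : ∀ p ∈ X, ∀ q ∈ X, p ≠ q → 1 ≤ dist p q) (x : EuclideanSpace ℝ (Fin 3))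
    {O : Finset (EuclideanSpace ℝ (Fin 3))} (hO : ExactOnly x O) (hOsub : O ⊆ X.filter fun q => dist x q = 1) :
    (X.filter fun q => dist x q = 1).card ≤ 11 ∨ IsClosePackedDozenAt x (X.filter fun q => dist x q = 1) := by
  classical
  set N := X.filter fun q => dist x q = 1 with hN
  have hkiss : IsKissingAround x N := isKissingAround_contacts X hX x
  have hle : N.card ≤ 12 := hkiss.card_le_twelve
  rcases Nat.lt_or_ge N.card 12 with hlt | hge
  · exact Or.inl (by omega)
  · exact Or.inr (hO N hOsub (le_antisymm hle hge) hkiss)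

/-- Equivalently: a TWELVE-fold ball carrying an exact-only own pattern inside its contacts is cp-saturated. -/
theorem closePacked_of_exactOnly_of_card_eq (X : Finset (EuclideanSpace ℝ (Fin 3)))
    (hX : ∀ p ∈ X, ∀ q ∈ X, p ≠ q → 1 ≤ dist p q) (x : EuclideanSpace ℝ (Fin 3))
    {O : Finset (EuclideanSpace ℝ (Fin 3))} (hO : ExactOnly x O) (hOsub : O ⊆ X.filter fun q => dist x q = 1)
    (h12 : (X.filter fun q => dist x q = 1).card = 12) :
    IsClosePackedDozenAt x (X.filter fun q => dist x q = 1) := by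
  rcases card_le_eleven_or_closePacked_of_exactOnly X hX x hO hOsub with h | h
  · omega
  · exact h

/-- **Transported form.**  With the certificate at the origin (`ExactOnly 0 O₀`, e.g. `exactOnly_star_of_p5Exhaustion`'s closed vertex star in the
cubic frame) and a rigid motion `p ↦ L p + x` carrying the own pattern INTO the contact shell of `x`: pay (`≤ 11` contacts) or propagate (cp dozen). -/
theorem card_le_eleven_or_closePacked_of_exactOnly_image (X : Finset (EuclideanSpace ℝ (Fin 3)))
    (hX : ∀ p ∈ X, ∀ q ∈ X, p ≠ q → 1 ≤ dist p q) (x : EuclideanSpace ℝ (Fin 3))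
    (L : EuclideanSpace ℝ (Fin 3) ≃ₗᵢ[ℝ] EuclideanSpace ℝ (Fin 3)) {O₀ : Finset (EuclideanSpace ℝ (Fin 3))}
    (hO₀ : ExactOnly 0 O₀) (hsub : ∀ p ∈ O₀, L p + x ∈ X ∧ dist x (L p + x) = 1) :
    (X.filter fun q => dist x q = 1).card ≤ 11 ∨ IsClosePackedDozenAt x (X.filter fun q => dist x q = 1) := by
  classical
  have hO : ExactOnly (L 0 + x) (O₀.image fun p => L p + x) := hO₀.image L x
  rw [map_zero, zero_add] at hO
  refine card_le_eleven_or_closePacked_of_exactOnly X hX x hO (fun q hq => ?_)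
  obtain ⟨p, hp, rfl⟩ := Finset.mem_image.1 hq
  exact Finset.mem_filter.2 (hsub p hp)

end Summit.Ventures.Crystal3D.Theorems

end
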